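import Literature.AlgebraicGeometry.Motives.SegreHyperplaneClass
import HarnessLib

/-!
# Weighted Segre embeddings of a product of two abelian varieties

Layer `Literature/AlgebraicGeometry/Motives`, companion of `Motives/SegreHyperplaneClass` and
`Motives/SegreHyperplaneClassProdCurve`. The purely geometric statement behind "a product polarization
`L_A ⊠ L_B^{⊗m}`" (R. Hartshorne, *Algebraic Geometry* II Ex. 5.11–5.12: `σ^*𝒪(1) ≅ 𝒪(1,1)` for the
Segre embedding `σ`; the Segre–diagonal power `s_{m-1}` with `s_{m-1}^*𝒪(1) = 𝒪(m)`), with NO curve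
hypothesis and no endomorphism data: for complex abelian varieties `A`, `B` there are projective
embeddings `e_A`, `e_B` with non-zero rational hyperplane classes `h_A = e_A^*a_A`, `h_B = e_B^*a_B` such
that for every weight `m ≥ 1` some projective embedding of `A × B` has hyperplane class
`pr_A^* h_A + m · pr_B^* h_B` (on `H²` of the complex points).

* `exists_weightedSegreEmbedding_prod` — the statement above.
* `exists_segreEmbedding_self_prod` — the square `A × A` with the SAME hyperplane class on both factors.

Everything is proved; no definition and no named fact is introduced (ingredients:
`exists_segreHyperplaneClasses`, `map_segrePow_of_additive`, `exists_closedImmersion_projectiveSpace_pos`).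

## References

* [Hartshorne1977] R. Hartshorne, Algebraic Geometry (1977), II Ex. 5.11 and Ex. 5.12.
* [Markman2025SurveySecant] E. Markman, arXiv:2509.23403, §11.5 Step 2 (product polarizations).
-/

noncomputable section

open CategoryTheory AlgebraicGeometry MonoidalCategory CartesianMonoidalCategory Function
open Literature.AlgebraicGeometry Literature.AlgebraicGeometry.Motives
  Literature.AlgebraicGeometry.HodgeTheory Literature.AlgebraicTopology.SingularHomology

namespace Literature.AlgebraicGeometry.Motives

open SegreHyperplaneClass

/-- **Weighted Segre embeddings of `A × B`** (Hartshorne II Ex. 5.11–5.12: the product polarization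
`L_A ⊠ L_B^{⊗m}`). For complex abelian varieties `A`, `B`: projective embeddings `e_A`, `e_B` and non-zero
rational classes `a_A`, `a_B` of the ambient projective spaces such that for every weight `m ≥ 1` the
Segre embedding of `e_A` with `s_{m-1}(e_B)` is a projective embedding of `A × B` with hyperplane class
`pr_A^*(e_A^*a_A) + m · pr_B^*(e_B^*a_B)` (Segre additivity on `H²`, `exists_segreHyperplaneClasses`;
`s_d^* g = (d+1) g`, `map_segrePow_of_additive`). [cite: Hartshorne1977, II Ex. 5.11 and Ex. 5.12]
[cite: Markman2025SurveySecant, §11.5 Step 2] -/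
theorem exists_weightedSegreEmbedding_prod (A B : AbelianVariety ℂ) :
    ∃ (eA : ProjectiveEmbedding A.X) (aA : complexBetti (projectiveSpace eA.n ℂ) 2)
      (eB : ProjectiveEmbedding B.X) (aB : complexBetti (projectiveSpace eB.n ℂ) 2),
      IsRationalClass aA ∧ aA ≠ 0 ∧ IsRationalClass aB ∧ aB ≠ 0 ∧
      ∀ m : ℕ, 0 < m →
        ∃ (e : ProjectiveEmbedding (A.prod B).X) (a : complexBetti (projectiveSpace e.n ℂ) 2),
          IsRationalClass a ∧ a ≠ 0 ∧
          complexBetti.map e.ι 2 a =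
            complexBetti.map (AbelianVariety.fst A B).hom.hom.hom 2 (complexBetti.map eA.ι 2 aA) +
            ((m : ℕ) : ℂ) • complexBetti.map (AbelianVariety.snd A B).hom.hom.hom 2 (complexBetti.map eB.ι 2 aB) := by
  obtain ⟨g, hgr, hgnz, hgσ⟩ := exists_segreHyperplaneClasses
  obtain ⟨N, e₀, hN, he₀⟩ := exists_closedImmersion_projectiveSpace_pos A
  obtain ⟨M, f₀, hM, hf₀⟩ := exists_closedImmersion_projectiveSpace_pos B
  haveI := he₀
  haveI := hf₀
  refine ⟨⟨N, e₀, he₀⟩, g N, ⟨M, f₀, hf₀⟩, g M, hgr N, hgnz N hN, hgr M, hgnz M hM, fun m hm ↦ ?_⟩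
  -- the weighted Segre embedding `(e₀ ⊗ s_{m-1}(f₀)) ≫ σ`
  obtain ⟨d₁, rfl⟩ : ∃ d, m = d + 1 := ⟨m - 1, by omega⟩
  obtain ⟨ιB, hιB⟩ : ∃ ι : B.X ⟶ projectiveSpace (ProjectiveSpace.segrePowDim M d₁) ℂ,
      ι = f₀ ≫ ProjectiveSpace.segrePow M ℂ d₁ := ⟨_, rfl⟩
  haveI := isClosedImmersion_segrePow_left M d₁
  haveI hιBci : IsClosedImmersion ιB.left := by
    rw [hιB]
    change IsClosedImmersion (f₀.left ≫ (ProjectiveSpace.segrePow M ℂ d₁).left)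
    infer_instance
  obtain ⟨ι, hι⟩ : ∃ ι : A.X ⊗ B.X ⟶
      projectiveSpace (N * ProjectiveSpace.segrePowDim M d₁ + N + ProjectiveSpace.segrePowDim M d₁) ℂ,
      ι = (e₀ ⊗ₘ ιB) ≫ segreEmbedding _ _ ℂ := ⟨_, rfl⟩
  haveI := isClosedImmersion_tensorHom_left (X := A.X) (Y := B.X) e₀ ιB
  have hιci : IsClosedImmersion ι.left := by
    rw [hι]
    change IsClosedImmersion ((e₀ ⊗ₘ ιB).left ≫ (segreEmbedding _ _ ℂ).left)
    infer_instance
  have hKK : 1 ≤ N * ProjectiveSpace.segrePowDim M d₁ + N + ProjectiveSpace.segrePowDim M d₁ :=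
    le_trans hN ((Nat.le_add_left _ _).trans (Nat.le_add_right _ _))
  refine ⟨⟨_, ι, hιci⟩, g _, hgr _, hgnz _ hKK, ?_⟩
  -- `ι_B^* g = m · f₀^* g`
  have hBcl : complexBetti.map ιB 2 (g _) = ((d₁ + 1 : ℕ) : ℂ) • complexBetti.map f₀ 2 (g M) := by
    rw [hιB, map_comp_apply', map_segrePow_of_additive g hgσ M d₁, map_smul]
  have final : complexBetti.map ι 2 (g _) =
      complexBetti.map (fst A.X B.X) 2 (complexBetti.map e₀ 2 (g N)) +
        ((d₁ + 1 : ℕ) : ℂ) • complexBetti.map (snd A.X B.X) 2 (complexBetti.map f₀ 2 (g M)) := by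
    rw [hι, map_comp_apply', hgσ, map_add, map_tensorHom_map_fst, map_tensorHom_map_snd, hBcl, map_smul]
  exact final

/-- **The Segre embedding of the square `A × A` with equal factors** (Hartshorne II Ex. 5.11–5.12, `𝒪(1,1)`): ONE
projective embedding `e_A` of `A` with a non-zero rational ambient class `a_A`, and a projective embedding of `A × A`
with hyperplane class `pr₁^*(e_A^*a_A) + pr₂^*(e_A^*a_A)` — the SAME class on both factors (so that one `K`-frame of
`(A, φ, h)` serves both factors of `(A × A, φ × φ)`). [cite: Hartshorne1977, II Ex. 5.11 and Ex. 5.12]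
[cite: Markman2025SurveySecant, §11.5 Step 2] -/
theorem exists_segreEmbedding_self_prod (A : AbelianVariety ℂ) :
    ∃ (eA : ProjectiveEmbedding A.X) (aA : complexBetti (projectiveSpace eA.n ℂ) 2)
      (e : ProjectiveEmbedding (A.prod A).X) (a : complexBetti (projectiveSpace e.n ℂ) 2),
      IsRationalClass aA ∧ aA ≠ 0 ∧ IsRationalClass a ∧ a ≠ 0 ∧
      complexBetti.map e.ι 2 a =
        complexBetti.map (AbelianVariety.fst A A).hom.hom.hom 2 (complexBetti.map eA.ι 2 aA) +
          complexBetti.map (AbelianVariety.snd A A).hom.hom.hom 2 (complexBetti.map eA.ι 2 aA) := by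
  obtain ⟨g, hgr, hgnz, hgσ⟩ := exists_segreHyperplaneClasses
  obtain ⟨N, e₀, hN, he₀⟩ := exists_closedImmersion_projectiveSpace_pos A
  haveI := he₀
  obtain ⟨ι, hι⟩ : ∃ ι : A.X ⊗ A.X ⟶ projectiveSpace (N * N + N + N) ℂ,
      ι = (e₀ ⊗ₘ e₀) ≫ segreEmbedding N N ℂ := ⟨_, rfl⟩
  haveI := isClosedImmersion_tensorHom_left (X := A.X) (Y := A.X) e₀ e₀
  have hιci : IsClosedImmersion ι.left := by
    rw [hι]
    change IsClosedImmersion ((e₀ ⊗ₘ e₀).left ≫ (segreEmbedding N N ℂ).left)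
    infer_instance
  have hKK : 1 ≤ N * N + N + N := le_trans hN ((Nat.le_add_left _ _).trans (Nat.le_add_right _ _))
  refine ⟨⟨N, e₀, he₀⟩, g N, ⟨_, ι, hιci⟩, g _, hgr N, hgnz N hN, hgr _, hgnz _ hKK, ?_⟩
  have final : complexBetti.map ι 2 (g _) =
      complexBetti.map (fst A.X A.X) 2 (complexBetti.map e₀ 2 (g N)) +
        complexBetti.map (snd A.X A.X) 2 (complexBetti.map e₀ 2 (g N)) := by
    rw [hι, map_comp_apply', hgσ, map_add, map_tensorHom_map_fst, map_tensorHom_map_snd]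
  exact final

end Literature.AlgebraicGeometry.Motives

end
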